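import Literature.NumberTheory.EllipticCurves.GreenbergVatsal2000.EisensteinCongruence
import Literature.NumberTheory.EllipticCurves.PAdicLFunctionBranch
import Mathlib.NumberTheory.LegendreSymbol.QuadraticChar.Basic
import HarnessLib

/-!
# Greenberg–Vatsal 2000, §3 Thm. (3.11) with display (28), at the EVEN quadratic character
# `χ = (·/p)` TAMELY RAMIFIED AT `p` (`p ≡ 1 (mod 4)`): the twisted Eisenstein congruence
# `L_{Σ₀}(E/ℚ, χ, T) ≡ u · L_{Σ₀}(C, χ, T) L_{Σ₀}(D, χ, T) (mod πΛ)` for `E/ℚ` GOOD ORDINARY at `p` with a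
# rational `p`-isogeny whose kernel is ramified at `p` and even — filed through its consequence for
# the `μ`- and `λ`-invariants (named fact; the `χ ≠ 1` instance of the TODO of `EisensteinCongruence.lean`)

HONEST FRAMING (cell `bsd-addord`, FULL-BSD rank-≤1 programme D-0033, seat `bsd-addord-twist`;
home `run/shared/lean/pub/bsd-addord/`): Literature = cited statements only. This file TYPES one
published NUMBERED statement as a named fact (`def … : Prop`, nothing asserted, no `_holds`):
Greenberg–Vatsal's Theorem (3.11) in the generality in which it is PRINTED — "Let `χ` be any even
character" of `G = Gal(K/ℚ)`, `K` an abelian field "unramified at all primes dividing the level `N`,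
and tamely ramified at `p`" (GV pp. 38–39) — specialised to the ONE even character the seat's memo
(`bsd-addord-twist-MEMO.md` §4, target T-X3-χ) needs: the quadratic character `χ = (·/p) = ω^{(p−1)/2}`
of `K = ℚ(√p) ⊂ ℚ(μ_p)`, even iff `p ≡ 1 (mod 4)`. The sibling fact
`thm311_hasUnitContent_iff_and_order_eq_of_lineRamifiedEven` (`EisensteinCongruence.lean`) is the
instance `χ = 1`; its `-- TODO(general form)` names exactly the present generalisation. Nothing
about elliptic curves is asserted; every consumer takes this `Prop` as an explicit hypothesis.

WHY THE SEAT NEEDS IT (context, not content): for `E` good ordinary at `p` the `χ`-twisted `p`-adic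
`L`-function `L(E/ℚ, χ, T)` of GV (24) is the `ω^{(p−1)/2}`-branch of the Mazur–Swinnerton-Dyer
measure (tree `padicLFunctionBranch f α ((p−1)/2)`, file `PAdicLFunctionBranch`), i.e. the cyclotomic
`p`-adic `L`-function of the ADDITIVE quadratic twist `E ⊗ χ = E^{(p)}` (Kodaira `I₀*` at `p`,
Delbourgo's setting (G)); the congruence below is the analytic half of a Greenberg–Vatsal argument
"along `χ`" for the reducible additive class X3 (memo §4, App. A). That argument is the seat's, not
GV's, and is NOT in this file.

## Citation header (held text `paper:arxiv-math_9906215` = GV 2000, dvips stream; the seat's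
## decoding `…/prover-bsd-addord-twist-g0-0/folder/work/lit/gv2000_decoded.txt`, page = file − 23)

* §3 p. 32 (standing hypothesis): "`p` … a fixed odd prime. We assume that `E` has either good
  ordinary or multiplicative reduction at `p`".
* pp. 38–39 (`p`-adic `L`-functions): "Thus let `K` be an abelian number field. We assume that `K` is
  unramified at all primes dividing the level `N`, and tamely ramified at `p`. The curve `E` is
  assumed of course to have ordinary reduction at `p`. Put `G = Gal(K/ℚ)`, and fix a character `χ`
  of `G`. … `O = ℤ_p[χ]` and `Λ = O⟦Γ⟧ = O⟦T⟧`. … the `χ`-twisted `p`-adic `L`-function of `f` is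
  defined to be a power series `L(f, χ, T) ∈ Λ ⊗ ℚ_p` satisfying the following interpolation
  property for every nontrivial character `ρ` of `Γ`: `L(f, χ, ζ − 1) = τ(χ⁻¹ρ⁻¹) · α_p(f)^{−m} ·
  L(f, χρ, 1)/((−2πi)Ω^±_f)` (24) … `p^m` is the conductor of `ρ` … The sign `±` is determined by
  `±1 = χ(−1)`"; Prop. (3.7): "Assume that the character `χ` is unramified at all primes dividing
  `N`, and that `χ` is tamely ramified at `p`. Then … `L(E/ℚ, χ, T) ∈ Λ`"; Cor. (3.8): "for any even
  character `χ`".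
* p. 41: "we want to prove the congruence (12) … we will prove a more general result by allowing a
  twist by a Dirichlet character `χ`. We will assume that `χ` is even. The `p`-adic `L`-function
  `L(C, χ, T) ∈ Λ` is characterized by the interpolation property `L(C, χ, ζ − 1) = L(C, χρ, 1) =
  L(χψ⁻¹ρ, 0)` (26) … `L(C, χ, T)` is related to the Kubota–Leopoldt `p`-adic `L`-function
  `L_p(χωψ⁻¹, s)` by `L_p(χωψ⁻¹, s) = L(C, χ, κ(γ)^{−s} − 1)` … (`ωψ⁻¹ = φ`)"; p. 42: "`L(D, χ, T)`
  … `L_p(ωχ⁻¹ψ⁻¹, s) = ½ L(D, χ, κ(γ)^s − 1)` … To obtain `L_{Σ₀}(D, χ, T)`, one multiplies by the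
  Euler factors `1 − χψ(l)l⁻¹(1 + T)^{f_l}` for all `l ∈ Σ₀`. … Suppose that `φ` and `ψ` are as
  before … We assume that `ψ` is odd and unramified at `p`, or equivalently that `φ` is even and
  ramified at `p`. In this case, the admissible sign is plus, and the canonical period is the real
  period of `E` … For each even Dirichlet character `χ`, we let `L(G, χ, T)` denote the `p`-adic
  `L`-function (associated to `G` and `χ`) … Then we clearly have `L(G, χ, T) = L_{Σ₀}(C, χ, T)
  L_{Σ₀}(D, χ, T)`. (28)"
* p. 43: "**Theorem (3.11)** Let `χ` be any even character. Then we have congruence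
  `L_{Σ₀}(E/ℚ, χ, T) ≡ u L(G, χ, T) (mod πΛ)`, where `u` is a unit in `O`." (Proof: `q`-expansion
  principle, Hida's ordinary Eisenstein series, Vatsal's Thm. (2.10) "`L(g, χ, ζ − 1) ≡ L(G, χ, ζ − 1)
  (mod π)` for every `ζ ≠ 1`".)

## The tree's vocabulary (no new definition) and the reading

`V/ℚ` globally minimal, `p ≠ 2` with `p ≡ 1 (mod 4)`, GOOD ORDINARY at `p` (`p ∤ a_p`; so `K = ℚ(√p)`
is unramified at every prime of the level and tamely ramified at `p`, as GV require); `Φ₀ ≤ V[p]` a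
rational line ramified at `p` and even with characters `φ` (mod `m`, primitive) and `ψ` (mod `d`,
primitive) presented through the cyclotomic characters exactly as in the `χ = 1` fact; `f` the
newform; `S₀ = Σ₀ ∌ p` finite ⊇ bad places `≠ p` of `V`; `χ := (quadraticChar (ZMod p))` composed
with `ℤ → ZMod p` — the Legendre symbol `(·/p)` with values in `𝔽_p`, as a Dirichlet character mod
`p` (GV p. 28: characters "having values in `ℤ_pˣ`" are read through the Teichmüller lift inside
`IsCharacterLFunctionC/D`); `W` ANY globally minimal model of the quadratic twist `V^{(p)} = V ⊗ χ`
(it enters only through its Euler factors at `S₀`: the depleted factors of `L(E/ℚ, χ, s) = L(V ⊗ χ, s)`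
at `l ∈ Σ₀` are those of `W`, tree `eulerFactorProduct W p S₀`); `ϖ ∈ ℚ` with `ϖ · Ω_V = Ω⁺_f`
(admissible sign plus, canonical period = real period, p. 42 / Cor. (3.8)); `B := padicLFunctionBranch
f (unitRoot V p) ((p−1)/2)`, the `ω^{(p−1)/2}`-branch of the Mazur–Swinnerton-Dyer measure
(Mazur–Tate–Teitelbaum §I.13; `(p−1)/2 = p / 2` is even, so this is the PLUS-symbol branch), and
`b ∈ Λ` with `ι b = ϖ · B`. READING of "`L_{Σ₀}(E/ℚ, χ, T)`" as `b · ∏𝒫_ℓ`: GV's `L(f, χ, T)` and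
the branch `B` interpolate the same twisted values `L(f, χρ, 1)/Ω⁺` up to the orientation
`ρ ↦ ρ⁻¹` of the variable (`T ↦ (1+T)⁻¹ − 1`) and Gauss-sum units (`τ(η)τ(η̄) = ±p^m`); as in the
`χ = 1` fact the statement is filed ONLY through the consequence for the reductions mod `p` — unit
content and `ord_T(· mod p)` — which is invariant under both. The twisted character `L`-functions:
by (26) `L(C, χ, ·)` is the function of `CharacterPAdicLFunctions.lean` for the EVEN character
`χφ = χωψ⁻¹` (`IsCharacterLFunctionC p (χ·φ) S₀`, modulus `p·m`), and by p. 42 `L_{Σ₀}(D, χ, ·)` is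
that file's `D`-function for the ODD character `χψ` (`IsCharacterLFunctionD p (ψ·χ) S₀`, modulus
`d·p`; its Euler factors `1 − χψ(l)l⁻¹(1+T)^{f_l}` and Kubota–Leopoldt relation `L_p(ω(χψ)⁻¹, s)` are
the definitions there with `ψ ↦ χψ`). TRANSCRIBED FOR GOOD ORDINARY `p` ONLY (printed also for
multiplicative `p`, where "unramified at all primes dividing the level" must be read as "≠ p").
`-- TODO(general form): every even character χ of an abelian K unramified at N-primes and tamely`
`-- ramified at p (GV pp. 38–43), O = ℤ_p[χ]; multiplicative reduction at p; the congruence itself`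
`-- with a CONSTANT unit u ∈ O rather than its μ/λ consequence.`
-/

noncomputable section

open scoped Classical MatrixGroups ModularForm

open NumberField IsDedekindDomain Field WeierstrassCurve CongruenceSubgroup PowerSeries
open Literature.NumberTheory.EllipticCurves Literature.NumberTheory.GaloisRepresentations
  Literature.NumberTheory.EllipticCurves.ModularForms
  Literature.NumberTheory.EllipticCurves.Rank1Residual

namespace Literature.NumberTheory.EllipticCurves.GreenbergVatsal2000

/-- **Greenberg–Vatsal 2000, §3 Thm. (3.11) with display (28), at `χ = (·/p)` (`p ≡ 1 (mod 4)`, so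
`χ` is EVEN and tamely ramified at `p`), good ordinary `p`: the twisted Eisenstein congruence
`L_{Σ₀}(E/ℚ, χ, T) ≡ u · L_{Σ₀}(C, χ, T) L_{Σ₀}(D, χ, T) (mod πΛ)`.** Thm. (3.11), p. 43: "Let `χ` be
any even character. Then we have congruence `L_{Σ₀}(E/ℚ, χ, T) ≡ u L(G, χ, T) (mod πΛ)`, where `u`
is a unit in `O`", in the set-up of pp. 38–39 ("`K` … unramified at all primes dividing the level
`N`, and tamely ramified at `p` … fix a character `χ` of `G = Gal(K/ℚ)`"), with (28), p. 42:
"`L(G, χ, T) = L_{Σ₀}(C, χ, T) L_{Σ₀}(D, χ, T)`", (26) p. 41: "`L_p(χωψ⁻¹, s) = L(C, χ, κ(γ)^{−s} − 1)`",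
p. 42: "`L_p(ωχ⁻¹ψ⁻¹, s) = ½ L(D, χ, κ(γ)^s − 1)` … Euler factors `1 − χψ(l)l⁻¹(1+T)^{f_l}`", and
p. 42: "`φ` … even and ramified at `p` … the admissible sign is plus, and the canonical period is the
real period". TRANSCRIPTION: `V/ℚ` globally minimal, `p ≠ 2`, `p ≡ 1 (mod 4)`, GOOD ORDINARY at `p`;
`Φ₀` a rational line ramified at `p` and even with primitive characters `φ` mod `m` (on `Φ₀`) and `ψ`
mod `d` (on `V[p]/Φ₀`), valued in `𝔽_p`; `f` the newform; `S₀ ∌ p` finite ⊇ bad places `≠ p`; `W` a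
globally minimal model of the twist `V^{(p)} = V ⊗ χ` (Euler factors at `S₀` of `L(V, χ, s)`);
`ϖ · Ω_V = Ω⁺_f`; `b ∈ Λ` with `ι b = ϖ · padicLFunctionBranch f α ((p−1)/2)` (`α` the unit root; the
`χ = ω^{(p−1)/2}`-branch of the Mazur–Swinnerton-Dyer measure, PLUS symbols) — `b · ∏𝒫_ℓ(W)`
represents `L_{Σ₀}(V/ℚ, χ, T)` up to orientation of `T` and units; `g_C`, `g_D` ANY solutions of
`IsCharacterLFunctionC p (χ·φ) S₀` (modulus `p·m`) and `IsCharacterLFunctionD p (ψ·χ) S₀` (modulus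
`d·p`), `χ = quadraticChar` valued in `𝔽_p`: then `b · ∏𝒫_ℓ` has unit content iff `g_C · g_D` does,
and in that case `ord_T((b·∏𝒫_ℓ) mod p) = ord_T((g_C·g_D) mod p)` — the form in which GV use the
congruence on p. 43, insensitive to `T ↦ (1+T)⁻¹ − 1` and to units. Named fact; nothing asserted.
-- TODO(general form): any even χ of an abelian K (unramified at N, tamely ramified at p), O = ℤ_p[χ];
-- multiplicative p; the congruence with a constant unit u.
[cite: GreenbergVatsal2000, §3 Thm. (3.11) (p. 43) with (24) and Prop. (3.7)–Cor. (3.8) (pp. 39–40), (26)–(28) (pp. 41–42), set-up pp. 38–39] -/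
def thm311_quadraticTwist_hasUnitContent_iff_and_order_eq_of_lineRamifiedEven : Prop :=
  ∀ (V : WeierstrassCurve ℚ) [V.IsGloballyMinimal] [V.IsElliptic] (p : ℕ) [Fact p.Prime]
    (W : WeierstrassCurve ℚ) [W.IsGloballyMinimal] [W.IsElliptic]
    {N : ℕ} [NeZero N] (f : CuspForm (Gamma0 N) 2)
    (S₀ : Finset (HeightOneSpectrum (𝓞 ℚ)))
    (Φ₀ : AddSubgroup (V.geomTorsion (p : ℤ)))
    (m : ℕ) [NeZero m] (φ : DirichletCharacter (ZMod p) m)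
    (d : ℕ) [NeZero d] (ψ : DirichletCharacter (ZMod p) d),
    p ≠ 2 → p % 4 = 1 →
    (V.HasGoodReductionAtPrime p ∧ ¬ (p : ℤ) ∣ V.frobeniusTrace p) →
    (∃ C : VariableChange ℚ, C • V.quadraticTwist (p : ℚ) = W) →
    IsRationalLine V p Φ₀ → ¬ LineUnramifiedAt V p Φ₀ → LineEven V p Φ₀ → IsNewformOf V f →
    φ.IsPrimitive → ψ.IsPrimitive →
    (∀ (σ : absoluteGaloisGroup ℚ), ∀ P ∈ Φ₀,
      σ • P = (φ ((modNCyclotomicCharacter ℚ m σ : (ZMod m)ˣ) : ZMod m)).val • P) →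
    (∀ (σ : absoluteGaloisGroup ℚ) (P : V.geomTorsion (p : ℤ)),
      σ • P - (ψ ((modNCyclotomicCharacter ℚ d σ : (ZMod d)ˣ) : ZMod d)).val • P ∈ Φ₀) →
    (∀ v ∈ S₀, ((p : ℕ) : 𝓞 ℚ) ∉ v.asIdeal) →
    (∀ v : HeightOneSpectrum (𝓞 ℚ), v ∉ S₀ → ((p : ℕ) : 𝓞 ℚ) ∉ v.asIdeal →
      V.HasGoodReductionAt v) →
    ∀ (ϖ : ℚ), (ϖ : ℝ) * V.realPeriodRat = plusPeriod f →
    ∀ (b : IwasawaAlgebra p),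
      iwasawaToPowerSeries p b =
        PowerSeries.C ((ϖ : ℚ) : ℚ_[p]) *
          padicLFunctionBranch f ((unitRoot V p : ℤ_[p]) : ℚ_[p]) (p / 2) →
    ∀ (gC gD : IwasawaAlgebra p),
      IsCharacterLFunctionC p
        (DirichletCharacter.changeLevel (dvd_mul_right p m)
            ((quadraticChar (ZMod p)).ringHomComp (Int.castRingHom (ZMod p))) *
          DirichletCharacter.changeLevel (dvd_mul_left m p) φ) S₀ gC →
      IsCharacterLFunctionD p
        (DirichletCharacter.changeLevel (dvd_mul_right d p) ψ *
          DirichletCharacter.changeLevel (dvd_mul_left p d)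
            ((quadraticChar (ZMod p)).ringHomComp (Int.castRingHom (ZMod p)))) S₀ gD →
      (HasUnitContent (b * eulerFactorProduct W p S₀) ↔ HasUnitContent (gC * gD)) ∧
        (HasUnitContent (gC * gD) →
          (PowerSeries.map (PadicInt.toZMod (p := p)) (b * eulerFactorProduct W p S₀)).order =
            (PowerSeries.map (PadicInt.toZMod (p := p)) (gC * gD)).order)

end Literature.NumberTheory.EllipticCurves.GreenbergVatsal2000

end
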